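import Summits.NavierStokesRegularity.NavierStokesRegularity.Theorems.SubcubicESSVelocityRescale
import Summits.NavierStokesRegularity.NavierStokesRegularity.Theorems.TypeICertificateLadderRungReynoldsOneTaoCover
import Literature.Analysis.FluidPDE.NSCriticalClosureTao
import HarnessLib

/-!
# Tools for `QuarterLogPincer.CubeBridge` (item stmt-NavierStokesRegularity-24078): the
# virtual-Type-I velocity clause at viscosity `ν`, and one Type-I envelope on `[0,T)`

Two helper lemmas for the cube bridge `TypeIQuantSubcubicExp → SuperlogCubeRate` of route
`QuarterLogPincer` (proof file `QuarterLogPincerCubeBridge.lean`):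

* `CubeBridge.norm_le_of_typeI_velocity_bound`: the viscosity rescaling `w(s,x) = ν⁻¹u(s/ν,x)`,
  `q(s,x) = ν⁻²p(s/ν,x)` (Tao 2013, footnote 3; `IsClassicalNSSolutionOn.viscosityRescale_zero`)
  transports an abstract velocity clause stated in Tao's class at `ν = 1` IN THE VIRTUAL TYPE-I
  SUB-CLASS `|u(t,x)| ≤ M (T+τ−t)^{-1/2}` (`τ > 0`; the class of route item `TypeIQuantSubcubicExp`,
  after Barker–Prange 2021) to viscosity `ν` on a closed slab `[0,T]`: the bound
  `|u(t,x)| ≤ √ν·M·(T+τ−t)^{-1/2}` becomes `|w(s,x)| ≤ M (νT+ντ−s)^{-1/2}`, `‖u(t)‖₃ ≤ νA` becomes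
  `‖w(s)‖₃ ≤ A`, and the conclusion reads `|u(t,x)| ≤ ν F(A) (νt)^{-1/2}`. It is
  `subcubicESS_norm_le_of_velocity_bound` (route SubcubicESS) with the extra Type-I transport.
* `CubeBridge.typeI_envelope`: for a classical solution on `[0,T)`, Leray–Hopf from a rapidly
  decaying datum, the eventual rate `IsTypeIBlowup u T` (`|u| ≤ C/√(T−t)` on some `(l,T)`) and the
  Tao-class sup bound on the early closed slab `[0,T']` (`RungReynoldsOne.stub_taoCover` +
  `exists_forall_norm_le_of_hasBoundedSobolevNormsOn`) give ONE constant `M ≥ 0` with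
  `|u(t,x)| ≤ M (T−t)^{-1/2}` on all of `[0,T)`.

HONEST FRAMING: bookkeeping lemmas; nothing about Navier–Stokes regularity is proved or claimed.
References: Tao, arXiv:1108.1165 footnote 3 (viscosity rescaling); Tao, arXiv:1908.04958 Thm 1.2
(shape of the velocity clause); Leray 1934 (the Type-I rate). [folklore]
-/

noncomputable section

open Set Filter Topology MeasureTheory Function
open scoped ENNReal NNReal
open Literature.Analysis Literature.Analysis.FluidPDE

namespace Summit.NavierStokesRegularity.NavierStokesRegularity.Theorems

-- the problem directory repeats the summit name (`NavierStokesRegularity/NavierStokesRegularity`)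
set_option linter.dupNamespace false

namespace CubeBridge


/-! ### Step 1: the Type-I velocity clause transported to viscosity `ν` -/

/-- **The virtual-Type-I velocity ESS clause at viscosity `ν`** (viscosity rescaling
`w(s,x) = ν⁻¹u(s/ν,x)`, `q(s,x) = ν⁻²p(s/ν,x)` of Tao 2013, footnote 3, applied to an abstract size
function `F` in the virtual Type-I class with constant `M`). Suppose every classical solution with
`ν = 1` on `[0,T] × ℝ³` in Tao's class obeying `|u(t,x)| ≤ M (T+τ−t)^{-1/2}` (`τ > 0`) and
`‖u(t)‖₃ ≤ A` on `[0,T]`, `A ≥ 2`, satisfies `|u(t,x)| ≤ F(A) t^{-1/2}` for `0 < t ≤ T`. If `(u,p)`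
is a classical solution of the unforced system with viscosity `ν > 0` on `[0,T] × ℝ³` with all
`L²` Sobolev norms of the slices bounded, `|u(t,x)| ≤ √ν·M·(T+τ−t)^{-1/2}` and `‖u(t)‖₃ ≤ νA` on
`[0,T]` (`A ≥ 2`, `τ > 0`), then `|u(t,x)| ≤ ν·F(A)·(νt)^{-1/2}` for `0 < t ≤ T`: the rescaled pair
is classical with viscosity `1` on `[0,νT]` (`IsClassicalNSSolutionOn.viscosityRescale_zero`), in
Tao's class, with `|w(s,x)| ≤ M (νT+ντ−s)^{-1/2}`, `‖w(s)‖₃ ≤ A`, and `u(t,x) = ν w(νt,x)`.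
Variant of `subcubicESS_norm_le_of_velocity_bound` (route SubcubicESS). [folklore] -/
theorem norm_le_of_typeI_velocity_bound {F : ℝ → ℝ} {M : ℝ}
    (hTao : ∀ (T τ A : ℝ) (u : ℝ → EuclideanSpace ℝ (Fin 3) → EuclideanSpace ℝ (Fin 3))
      (p : ℝ → EuclideanSpace ℝ (Fin 3) → ℝ),
      (IsClassicalNSSolutionOn (Icc 0 T) 1 0 u p ∧
        ∀ n : ℕ, ∃ C : ℝ≥0, ∀ t ∈ Icc 0 T, eLpNorm (iteratedFDeriv ℝ n (u t)) 2 volume ≤ C) →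
      0 < τ →
      (∀ t ∈ Icc 0 T, ∀ x : EuclideanSpace ℝ (Fin 3), ‖u t x‖ ≤ M * (T + τ - t) ^ (-(1 / 2 : ℝ))) →
      (∀ t ∈ Icc 0 T, eLpNorm (u t) 3 volume ≤ ENNReal.ofReal A) → 2 ≤ A →
      ∀ t ∈ Ioc 0 T, ∀ x : EuclideanSpace ℝ (Fin 3), ‖u t x‖ ≤ F A * t ^ (-(1 / 2 : ℝ)))
    {ν T τ A : ℝ} (hν : 0 < ν) (hT : 0 < T) (hτ : 0 < τ) (hA : 2 ≤ A)
    {u : ℝ → EuclideanSpace ℝ (Fin 3) → EuclideanSpace ℝ (Fin 3)}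
    {p : ℝ → EuclideanSpace ℝ (Fin 3) → ℝ} (hsol : IsClassicalNSSolutionOn (Icc 0 T) ν 0 u p)
    (hHk : HasBoundedSobolevNormsOn (Icc 0 T) u)
    (hM : ∀ t ∈ Icc 0 T, ∀ x : EuclideanSpace ℝ (Fin 3),
      ‖u t x‖ ≤ Real.sqrt ν * M * (T + τ - t) ^ (-(1 / 2 : ℝ)))
    (hN : ∀ t ∈ Icc 0 T, eLpNorm (u t) 3 volume ≤ ENNReal.ofReal (ν * A)) :
    ∀ t ∈ Ioc 0 T, ∀ x : EuclideanSpace ℝ (Fin 3),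
      ‖u t x‖ ≤ ν * F A * (ν * t) ^ (-(1 / 2 : ℝ)) := by
  set w : ℝ → EuclideanSpace ℝ (Fin 3) → EuclideanSpace ℝ (Fin 3) := timeRescale ν⁻¹ ν⁻¹ u
    with hw
  set q : ℝ → EuclideanSpace ℝ (Fin 3) → ℝ := timeRescale ν⁻¹ (ν⁻¹ ^ 2) p with hq
  have hν' : 0 ≤ ν⁻¹ := inv_nonneg.2 hν.le
  have hν0 : ν ≠ 0 := hν.ne'
  -- the rescaled pair is classical with viscosity `1` on `[0, νT]`
  have hwsol : IsClassicalNSSolutionOn (Icc 0 (ν * T)) 1 0 w q :=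
    hsol.viscosityRescale_zero hν hT
  -- Tao's class: Sobolev bounds of the slices
  have hwHk : IsClassicalNSSolutionOn (Icc 0 (ν * T)) 1 0 w q ∧
      ∀ n : ℕ, ∃ C : ℝ≥0, ∀ s ∈ Icc 0 (ν * T),
        eLpNorm (iteratedFDeriv ℝ n (w s)) 2 volume ≤ C := by
    refine ⟨hwsol, fun n => ?_⟩
    obtain ⟨Cn, hCn⟩ := hHk n
    refine ⟨‖ν⁻¹‖₊ * max 1 Cn, fun s hs => ?_⟩
    have ht : ν⁻¹ * s ∈ Icc 0 T := mapsTo_inv_mul_Icc hν hs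
    have hslice : w s = fun x => ν⁻¹ • u (ν⁻¹ * s) x := timeRescale_slice _ _ _ _
    have hderiv : iteratedFDeriv ℝ n (w s) = fun x => ν⁻¹ • iteratedFDeriv ℝ n (u (ν⁻¹ * s)) x := by
      funext x
      rw [hslice]
      exact iteratedFDeriv_const_smul_apply'
        (((hsol.contDiff_velocity ht).of_le (by exact_mod_cast le_top)).contDiffAt)
    rw [hderiv]
    calc eLpNorm (fun x => ν⁻¹ • iteratedFDeriv ℝ n (u (ν⁻¹ * s)) x) 2 volume
        = ‖ν⁻¹‖ₑ * eLpNorm (iteratedFDeriv ℝ n (u (ν⁻¹ * s))) 2 volume :=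
          eLpNorm_const_smul ν⁻¹ (iteratedFDeriv ℝ n (u (ν⁻¹ * s))) 2 volume
      _ ≤ ‖ν⁻¹‖ₑ * max 1 (Cn : ℝ≥0∞) := by
          gcongr
          exact eLpNorm_two_le_max_of_lintegral_sq_le (hCn _ ht)
      _ = ((‖ν⁻¹‖₊ * max 1 Cn : ℝ≥0) : ℝ≥0∞) := by
          rw [ENNReal.coe_mul, ENNReal.coe_max, ENNReal.coe_one, enorm_eq_nnnorm]
  -- the virtual Type-I bound of the slices, `τ' = ντ`
  have hsqrt : (ν⁻¹ : ℝ) ^ (-(1 / 2 : ℝ)) = Real.sqrt ν := by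
    rw [Real.inv_rpow hν.le, Real.rpow_neg hν.le, inv_inv, Real.sqrt_eq_rpow]
  have hwM : ∀ s ∈ Icc 0 (ν * T), ∀ x : EuclideanSpace ℝ (Fin 3),
      ‖w s x‖ ≤ M * (ν * T + ν * τ - s) ^ (-(1 / 2 : ℝ)) := by
    intro s hs x
    have ht : ν⁻¹ * s ∈ Icc 0 T := mapsTo_inv_mul_Icc hν hs
    have hX : 0 ≤ ν * T + ν * τ - s := by nlinarith [hs.2, mul_pos hν hτ]
    have h1 := hM _ ht x
    have hresc : T + τ - ν⁻¹ * s = ν⁻¹ * (ν * T + ν * τ - s) := by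
      field_simp
    rw [hresc, Real.mul_rpow hν' hX, hsqrt] at h1
    rw [hw, timeRescale_apply, norm_smul, Real.norm_of_nonneg hν']
    calc ν⁻¹ * ‖u (ν⁻¹ * s) x‖
        ≤ ν⁻¹ * (Real.sqrt ν * M * (Real.sqrt ν * (ν * T + ν * τ - s) ^ (-(1 / 2 : ℝ)))) :=
          mul_le_mul_of_nonneg_left h1 hν'
      _ = ν⁻¹ * (Real.sqrt ν * Real.sqrt ν) * M * (ν * T + ν * τ - s) ^ (-(1 / 2 : ℝ)) := by
          ring
      _ = M * (ν * T + ν * τ - s) ^ (-(1 / 2 : ℝ)) := by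
          rw [Real.mul_self_sqrt hν.le, inv_mul_cancel₀ hν0, one_mul]
  -- the critical norm of the slices
  have hwL3 : ∀ s ∈ Icc 0 (ν * T), eLpNorm (w s) 3 volume ≤ ENNReal.ofReal A := by
    intro s hs
    have ht : ν⁻¹ * s ∈ Icc 0 T := mapsTo_inv_mul_Icc hν hs
    have hslice : w s = fun x => ν⁻¹ • u (ν⁻¹ * s) x := timeRescale_slice _ _ _ _
    rw [hslice]
    calc eLpNorm (fun x => ν⁻¹ • u (ν⁻¹ * s) x) 3 volume
        = ‖ν⁻¹‖ₑ * eLpNorm (u (ν⁻¹ * s)) 3 volume := eLpNorm_const_smul ν⁻¹ (u (ν⁻¹ * s)) 3 volume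
      _ ≤ ENNReal.ofReal ν⁻¹ * ENNReal.ofReal (ν * A) := by
          rw [Real.enorm_eq_ofReal hν']
          gcongr
          exact hN _ ht
      _ = ENNReal.ofReal (ν⁻¹ * (ν * A)) := (ENNReal.ofReal_mul hν').symm
      _ = ENNReal.ofReal A := by rw [← mul_assoc, inv_mul_cancel₀ hν0, one_mul]
  have hbound := hTao (ν * T) (ν * τ) A w q hwHk (mul_pos hν hτ) hwM hwL3 hA
  -- read off the bound at `s = νt`
  intro t ht x
  have hs : ν * t ∈ Ioc 0 (ν * T) := ⟨mul_pos hν ht.1, mul_le_mul_of_nonneg_left ht.2 hν.le⟩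
  have h1 := hbound (ν * t) hs x
  have hval : w (ν * t) x = ν⁻¹ • u t x := by
    rw [hw, timeRescale_apply, ← mul_assoc, inv_mul_cancel₀ hν0, one_mul]
  rw [hval, norm_smul, Real.norm_of_nonneg hν', inv_mul_le_iff₀ hν] at h1
  calc ‖u t x‖ ≤ ν * (F A * (ν * t) ^ (-(1 / 2 : ℝ))) := h1
    _ = ν * F A * (ν * t) ^ (-(1 / 2 : ℝ)) := (mul_assoc _ _ _).symm

/-! ### Step 2: one Type-I envelope on the whole of `[0,T)` -/

/-- **A global virtual Type-I envelope.** For a classical solution of the unforced system on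
`ℝ³ × [0,T)`, Leray–Hopf from its rapidly decaying datum, the (eventual) velocity Type-I rate
`IsTypeIBlowup u T` upgrades to ONE constant `M ≥ 0` with `|u(t,x)| ≤ M (T−t)^{-1/2}` for ALL
`t ∈ [0,T)`: the Type-I bound holds on some `(l,T)`, and on the early closed slab `[0,T']`
(`l < T' < T`) the Tao cover (`RungReynoldsOne.stub_taoCover`) puts `u` in the `H^k` class, where it
is bounded (`exists_forall_norm_le_of_hasBoundedSobolevNormsOn`, Sobolev imbedding), and a constant
is `≤ B√T·(T−t)^{-1/2}`. [folklore] -/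
theorem typeI_envelope {ν T : ℝ} (hν : 0 < ν) (hT : 0 < T)
    {u : ℝ → EuclideanSpace ℝ (Fin 3) → EuclideanSpace ℝ (Fin 3)}
    {p : ℝ → EuclideanSpace ℝ (Fin 3) → ℝ} (hcl : IsClassicalNSSolutionOn (Ico 0 T) ν 0 u p)
    (hLH : IsLerayHopfOn T ν 0 (u 0) u) (hdec : HasRapidSpatialDecay (u 0))
    (hI : IsTypeIBlowup u T) :
    ∃ M : ℝ, 0 ≤ M ∧ ∀ t ∈ Ico 0 T, ∀ x : EuclideanSpace ℝ (Fin 3),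
      ‖u t x‖ ≤ M * (T - t) ^ (-(1 / 2 : ℝ)) := by
  obtain ⟨C, hC⟩ := hI
  obtain ⟨l, hlT, hl⟩ := mem_nhdsLT_iff_exists_Ioo_subset.1 hC
  -- the early closed slab `[0, T']`, `max l 0 < T' < T`
  set T' : ℝ := (max l 0 + T) / 2 with hT'
  have hl0T : max l 0 < T := max_lt hlT hT
  have hT'0 : 0 < T' := by
    have := le_max_right l 0
    rw [hT']
    linarith
  have hT'T : T' < T := by rw [hT']; linarith
  have hlT' : l < T' := by
    have := le_max_left l 0
    rw [hT']
    linarith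
  obtain ⟨q, hclq, hHk, -, -⟩ := RungReynoldsOne.stub_taoCover hν hT hcl hLH hdec ⟨hT'0, hT'T⟩
  obtain ⟨B, hB0, hB⟩ := exists_forall_norm_le_of_hasBoundedSobolevNormsOn hclq hHk
  refine ⟨max |C| (B * Real.sqrt T), le_max_of_le_left (abs_nonneg _), fun t ht x => ?_⟩
  have hTt : 0 < T - t := sub_pos.2 ht.2
  have hrpow : (T - t) ^ (-(1 / 2 : ℝ)) = (Real.sqrt (T - t))⁻¹ := by
    rw [Real.rpow_neg hTt.le, Real.sqrt_eq_rpow]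
  have hsq0 : 0 < Real.sqrt (T - t) := Real.sqrt_pos.2 hTt
  rcases le_or_gt t T' with h | h
  · -- early times: the Sobolev-class sup bound
    have hux : ‖u t x‖ ≤ B := hB t ⟨ht.1, h⟩ x
    have hsqle : Real.sqrt (T - t) ≤ Real.sqrt T := Real.sqrt_le_sqrt (by linarith [ht.1])
    have hone : 1 ≤ Real.sqrt T * (T - t) ^ (-(1 / 2 : ℝ)) := by
      rw [hrpow, ← div_eq_mul_inv, one_le_div hsq0]
      exact hsqle
    calc ‖u t x‖ ≤ B * 1 := by rw [mul_one]; exact hux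
      _ ≤ B * (Real.sqrt T * (T - t) ^ (-(1 / 2 : ℝ))) := mul_le_mul_of_nonneg_left hone hB0
      _ = B * Real.sqrt T * (T - t) ^ (-(1 / 2 : ℝ)) := (mul_assoc _ _ _).symm
      _ ≤ max |C| (B * Real.sqrt T) * (T - t) ^ (-(1 / 2 : ℝ)) :=
          mul_le_mul_of_nonneg_right (le_max_right _ _) (by rw [hrpow]; positivity)
  · -- late times: the Type-I rate
    have hux : ‖u t x‖ ≤ C / Real.sqrt (T - t) := hl ⟨hlT'.trans h, ht.2⟩ x
    calc ‖u t x‖ ≤ C / Real.sqrt (T - t) := hux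
      _ ≤ |C| / Real.sqrt (T - t) := div_le_div_of_nonneg_right (le_abs_self C) hsq0.le
      _ = |C| * (T - t) ^ (-(1 / 2 : ℝ)) := by rw [hrpow, div_eq_mul_inv]
      _ ≤ max |C| (B * Real.sqrt T) * (T - t) ^ (-(1 / 2 : ℝ)) :=
          mul_le_mul_of_nonneg_right (le_max_left _ _) (by rw [hrpow]; positivity)

end CubeBridge

end Summit.NavierStokesRegularity.NavierStokesRegularity.Theorems

end
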